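import Mathlib
import Summits.MatrixMultiplication.MatrixMultiplication.Theses.PauliSmithLocalisation

/-!
# MatrixMultiplication / PauliSmithLocalisation — crux `TargetsGiveGap`
(stmt-MatrixMultiplication-15043)

The dictionary glue of route PauliSmithLocalisation:

  `FixedPointFreeTargets → SmithPhaseGap`.

Fix the data `(p, δ, k₀)` of `FixedPointFreeTargets` and `k ≥ k₀`; instantiate the universally
quantified Pauli matrices `P` and the sandwich action `act` by their defining formulas (the pinning
hypotheses hold by `rfl`).  Let `M = ⟨n,n,n⟩` on the index set `I × I` (`I = Fin k → ZMod p`,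
`n = p^k`), i.e. `M a b c = [a.1 = b.1 ∧ b.2 = c.1 ∧ a.2 = c.2]`.  Then

* `M ≠ 0` (the entry at `((0,0),(0,0),(0,0))` is `1`);
* `bR M ≤ bR (matMulTensor ℂ (p^k) (p^k) (p^k))`: relabel along `I ≃ Fin (p^k)`
  (`Fintype.equivFinOfCardEq`); precomposing an approximate decomposition with the relabelling is
  again an approximate decomposition, so the infimum can only go down
  (`exists_isApproxDecomposition`, `ciInf_mono`, `csInf_le_csInf`);
* `act g M = M` for every `g`: the Pauli rows are orthonormal,
  `∑ i, conj (P x z u i) * P x z u' i = [u = u']` (single support `i = u - x`, unimodular phase),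
  and the six-fold sum `act g M a b c` factors into three such row sums (`key6`).

If `(p^k)^(2+δ) < bR(⟨p^k,p^k,p^k⟩)` failed, the target `(ρ, f)` at level
`r = bR(⟨p^k,p^k,p^k⟩) ≤ (p^k)^(2+δ)` would satisfy `f M = f (act g M) = ρ g • f M` for all `g`,
so `f M = 0` (no non-zero `ρ`-fixed vector) — contradicting `f ≠ 0` on `S_r ∖ {0}`.

This is the `hG` block of the route's deciding theorem `…Theses.PauliSmithLocalisation.closes`
(route file rev 8), ported verbatim to a standalone theorem whose type is the route decl.

References: M. Bläser, *Fast Matrix Multiplication*, Theory of Computing Graduate Surveys 5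
(2013) (border rank); D. Gross, *Hudson's theorem for finite-dimensional quantum systems*,
J. Math. Phys. 47 (2006) (Weyl–Heisenberg / generalised Pauli matrices).
-/

set_option linter.dupNamespace false

noncomputable section

namespace Summit.MatrixMultiplication.MatrixMultiplication.Theorems

open scoped BigOperators ComplexConjugate Classical
open Literature.Computability.AlgebraicComplexity

/-- **Crux `TargetsGiveGap` of route PauliSmithLocalisation** (stmt-MatrixMultiplication-15043),
exact route decl: `FixedPointFreeTargets → SmithPhaseGap`.  The matrix multiplication tensor
`M = ⟨p^k,p^k,p^k⟩` on `(Fin k → ZMod p) × (Fin k → ZMod p)` is a non-zero vector of border rank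
`≤ bR(⟨p^k,p^k,p^k⟩)` fixed by the Pauli sandwich action (Pauli rows are orthonormal), so a
fixed-point-free target at level `r = bR(⟨p^k,p^k,p^k⟩) ≤ (p^k)^(2+δ)` would force `f M = 0`,
contradiction; hence `(p^k)^(2+δ) < bR(⟨p^k,p^k,p^k⟩)` for all `k ≥ k₀`. [folklore]
[cite: Blaser2013, §6] [cite: Gross2006, §II] -/
theorem targetsGiveGap_proof :
    Summit.MatrixMultiplication.MatrixMultiplication.Theses.PauliSmithLocalisation.TargetsGiveGap := by
  unfold Summit.MatrixMultiplication.MatrixMultiplication.Theses.PauliSmithLocalisation.TargetsGiveGap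
    Summit.MatrixMultiplication.MatrixMultiplication.Theses.PauliSmithLocalisation.FixedPointFreeTargets
    Summit.MatrixMultiplication.MatrixMultiplication.Theses.PauliSmithLocalisation.SmithPhaseGap
  classical
  rintro ⟨p, hp, δ, hδ, k₀, hk⟩
  refine ⟨p, hp.out, δ, hδ, k₀, fun k hk₀ => ?_⟩
  by_contra hcon
  rw [not_lt] at hcon
  -- Pauli matrices and the sandwich action, by their defining formulas
  set P := fun x z u v : Fin k → ZMod p => if u = v + x then
    Complex.exp (2 * Real.pi * Complex.I * ((∑ i, z i * v i).val : ℂ) / (p : ℂ)) else (0 : ℂ)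
  have hP : ∀ x z u v, P x z u v = if u = v + x then
      Complex.exp (2 * Real.pi * Complex.I * ((∑ i, z i * v i).val : ℂ) / (p : ℂ)) else 0 :=
    fun _ _ _ _ => rfl
  set act := fun (g : ((Fin k → ZMod p) × (Fin k → ZMod p)) × ((Fin k → ZMod p) × (Fin k → ZMod p))
      × ((Fin k → ZMod p) × (Fin k → ZMod p)))
    (x : (Fin k → ZMod p) × (Fin k → ZMod p) → (Fin k → ZMod p) × (Fin k → ZMod p) →
      (Fin k → ZMod p) × (Fin k → ZMod p) → ℂ) (a b c : (Fin k → ZMod p) × (Fin k → ZMod p)) =>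
      ∑ a', ∑ b', ∑ c',
      (starRingEnd ℂ (P g.1.1 g.1.2 a.1 a'.1) * P g.2.2.1 g.2.2.2 a.2 a'.2) *
      (P g.1.1 g.1.2 b.1 b'.1 * starRingEnd ℂ (P g.2.1.1 g.2.1.2 b.2 b'.2)) *
      (P g.2.1.1 g.2.1.2 c.1 c'.1 * starRingEnd ℂ (P g.2.2.1 g.2.2.2 c.2 c'.2)) * x a' b' c'
    with hact
  -- the target at level r = bR(⟨p^k,p^k,p^k⟩) ≤ (p^k)^(2+δ)
  obtain ⟨d, ρ, f, -, -, hρfix, -, hfne, hfeq⟩ :=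
    hk k hk₀ P hP act (fun _ _ _ _ _ => rfl) _ hcon
  -- M = ⟨n,n,n⟩ on the index set I × I
  set M := fun a b c : (Fin k → ZMod p) × (Fin k → ZMod p) =>
    if a.1 = b.1 ∧ b.2 = c.1 ∧ a.2 = c.2 then (1 : ℂ) else 0
  have hM : ∀ a b c, M a b c = if a.1 = b.1 ∧ b.2 = c.1 ∧ a.2 = c.2 then 1 else 0 :=
    fun _ _ _ => rfl
  -- (i) M ≠ 0
  have hM0 : M ≠ 0 := by
    intro h
    have h1 := congrFun (congrFun (congrFun h (0, 0)) (0, 0)) (0, 0)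
    rw [hM] at h1
    simp at h1
  -- (ii) bR M ≤ bR ⟨p^k,p^k,p^k⟩: relabel I ≃ Fin (p^k); precomposition does not increase bR
  have hcard : Fintype.card (Fin k → ZMod p) = p ^ k := by simp [ZMod.card]
  obtain ⟨e⟩ : Nonempty ((Fin k → ZMod p) ≃ Fin (p ^ k)) := ⟨Fintype.equivFinOfCardEq hcard⟩
  have hMe : M = fun a b c =>
      matMulTensor ℂ (p ^ k) (p ^ k) (p ^ k) (Prod.map e e a) (Prod.map e e b) (Prod.map e e c) := by
    funext a b c
    rw [hM]
    simp [matMulTensor]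
  have hbR : algBorderRank M ≤ algBorderRank (matMulTensor ℂ (p ^ k) (p ^ k) (p ^ k)) := by
    rw [hMe]
    refine ciInf_mono ⟨0, fun _ _ => Nat.zero_le _⟩ fun h =>
      csInf_le_csInf ⟨0, fun _ _ => Nat.zero_le _⟩ ?_ ?_
    · obtain ⟨r, u, v, w, H⟩ :=
        exists_isApproxDecomposition h (matMulTensor ℂ (p ^ k) (p ^ k) (p ^ k))
      exact ⟨r, u, v, w, H⟩
    · rintro r ⟨u, v, w, H⟩
      exact ⟨fun ρ a => u ρ (Prod.map e e a), fun ρ b => v ρ (Prod.map e e b),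
        fun ρ c => w ρ (Prod.map e e c),
        fun a b c j hj => H (Prod.map e e a) (Prod.map e e b) (Prod.map e e c) j hj⟩
  -- (iii) M is fixed: Pauli rows are orthonormal
  have hphase : ∀ m : ℕ, starRingEnd ℂ (Complex.exp (2 * Real.pi * Complex.I * (m : ℂ) / (p : ℂ))) *
      Complex.exp (2 * Real.pi * Complex.I * (m : ℂ) / (p : ℂ)) = 1 := by
    intro m
    rw [← Complex.exp_conj, ← Complex.exp_add]
    have hc : starRingEnd ℂ (2 * Real.pi * Complex.I * (m : ℂ) / (p : ℂ)) =
        -(2 * Real.pi * Complex.I * (m : ℂ) / (p : ℂ)) := by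
      simp only [map_div₀, map_mul, map_natCast, Complex.conj_ofReal, Complex.conj_I, map_ofNat]
      ring
    rw [hc, neg_add_cancel, Complex.exp_zero]
  have horth : ∀ x z u u' : Fin k → ZMod p,
      ∑ i, starRingEnd ℂ (P x z u i) * P x z u' i = if u = u' then 1 else 0 := by
    intro x z u u'
    have hu : u = u - x + x := (sub_add_cancel u x).symm
    rw [Finset.sum_eq_single (u - x)]
    · rw [hP, hP, if_pos hu]
      by_cases h : u = u'
      · subst h
        rw [if_pos hu, if_pos rfl, hphase]
      · rw [if_neg (fun h' => h (hu.trans h'.symm)), if_neg h, mul_zero]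
    · intro i _ hi
      rw [hP x z u i, if_neg (fun h' => hi ?_), map_zero, zero_mul]
      rw [h', add_sub_cancel_right]
    · intro h; exact absurd (Finset.mem_univ _) h
  have horth' : ∀ x z u u' : Fin k → ZMod p,
      ∑ i, P x z u i * starRingEnd ℂ (P x z u' i) = if u = u' then 1 else 0 := by
    intro x z u u'
    rw [show (∑ i, P x z u i * starRingEnd ℂ (P x z u' i)) =
        ∑ i, starRingEnd ℂ (P x z u' i) * P x z u i from
      Finset.sum_congr rfl fun _ _ => mul_comm _ _, horth]
    by_cases h : u = u'
    · rw [if_pos h, if_pos h.symm]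
    · rw [if_neg h, if_neg (fun h' => h h'.symm)]
  -- the six-fold sum against M factors into three single sums
  have key6 : ∀ (α ζ α' β β' γ : (Fin k → ZMod p) → ℂ),
      (∑ a', ∑ b', ∑ c', (α a'.1 * ζ a'.2) * (α' b'.1 * β b'.2) * (β' c'.1 * γ c'.2) * M a' b' c')
        = (∑ i, α i * α' i) * (∑ j, ζ j * γ j) * (∑ l, β l * β' l) := by
    intro α ζ α' β β' γ
    have step1 : ∀ a' b' : (Fin k → ZMod p) × (Fin k → ZMod p),
        (∑ c', (α a'.1 * ζ a'.2) * (α' b'.1 * β b'.2) * (β' c'.1 * γ c'.2) * M a' b' c') =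
        if a'.1 = b'.1 then (α a'.1 * ζ a'.2) * (α' b'.1 * β b'.2) * (β' b'.2 * γ a'.2) else 0 := by
      intro a' b'
      by_cases h : a'.1 = b'.1
      · rw [if_pos h, Finset.sum_eq_single (b'.2, a'.2)]
        · rw [hM, if_pos ⟨h, rfl, rfl⟩, mul_one]
        · rintro ⟨c1, c2⟩ - hne
          rw [hM, if_neg, mul_zero]
          rintro ⟨-, h1, h2⟩
          exact hne (Prod.ext h1.symm h2.symm)
        · intro h'; exact absurd (Finset.mem_univ _) h'
      · rw [if_neg h]
        refine Finset.sum_eq_zero fun c' _ => ?_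
        rw [hM, if_neg (fun h' => h h'.1), mul_zero]
    have step2 : ∀ a' : (Fin k → ZMod p) × (Fin k → ZMod p),
        (∑ b' : (Fin k → ZMod p) × (Fin k → ZMod p), if a'.1 = b'.1 then
          (α a'.1 * ζ a'.2) * (α' b'.1 * β b'.2) * (β' b'.2 * γ a'.2) else 0) =
        ∑ l, (α a'.1 * ζ a'.2) * (α' a'.1 * β l) * (β' l * γ a'.2) := by
      intro a'
      rw [Fintype.sum_prod_type, Finset.sum_comm]
      simp only [Finset.sum_ite_eq, Finset.mem_univ, if_true]
    simp_rw [step1, step2]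
    rw [Fintype.sum_prod_type, Finset.sum_mul_sum, Finset.sum_mul]
    refine Finset.sum_congr rfl fun i _ => ?_
    rw [Finset.sum_mul]
    refine Finset.sum_congr rfl fun j _ => ?_
    rw [Finset.mul_sum]
    exact Finset.sum_congr rfl fun l _ => by ring
  have hfix : ∀ g, act g M = M := by
    intro g
    funext a b c
    simp only [hact]
    rw [key6 (fun i => starRingEnd ℂ (P g.1.1 g.1.2 a.1 i)) (fun j => P g.2.2.1 g.2.2.2 a.2 j)
      (fun i => P g.1.1 g.1.2 b.1 i) (fun l => starRingEnd ℂ (P g.2.1.1 g.2.1.2 b.2 l))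
      (fun l => P g.2.1.1 g.2.1.2 c.1 l) (fun j => starRingEnd ℂ (P g.2.2.1 g.2.2.2 c.2 j)),
      horth, horth', horth, hM]
    by_cases h1 : a.1 = b.1 <;> by_cases h2 : b.2 = c.1 <;> by_cases h3 : a.2 = c.2 <;>
      simp [h1, h2, h3]
  -- f M is a ρ-fixed vector, hence 0: contradiction
  have hfM : f M = 0 := hρfix (f M) fun g => by
    have h := hfeq g M hbR
    rw [hfix g] at h
    exact h.symm
  exact hfne M hM0 hbR hfM

end Summit.MatrixMultiplication.MatrixMultiplication.Theorems
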